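import Mathlib

/-!
# The served-set lemma: small values at spaced points force nearby roots (kernel form)

Soloist file (informed mode, seat `solo-Schanuel-informed`, s179).  This is the SERVED-SET LEMMA
of the seat's note `paper/AE-note.md` §3 as a kernel theorem — the elementary step that turns the
small-value hypothesis of [cite: Roy2010, Thm 1.1] (`|Q(cξ + η)| ≤ e^{-V}` at the points
`z_c = cξ + η`, `c` in a finite set `C` of naturals) into the SERVED data consumed by the kernel
Lemma AE (`soloAE_lemmaAE`, file `SoloInformedLemmaAE`): a large subset `S ⊆ C` and an
injective choice of root indices `ι` with `‖ρ (ι c) − z_c‖ ≤ e^{-W}`.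

Setting.  `Q : ℂ[X]` with `1 ≤ ‖leadingCoeff Q‖` (e.g. the image of a non-zero integer
polynomial), complex roots enumerated with multiplicity by `ρ : Fin D → ℂ`
(`univ.val.map ρ = Q.roots`, so `D = natDegree Q`), `D ≤ N`; points `z_c = c ξ + η`; the disc
about `z_c` is `{w : ‖w − z_c‖ < ‖ξ‖/2}` and `m_c` = the number of root indices in it; a real
`c₁` with `exp (−c₁) ≤ min 1 (‖ξ‖/2)` (i.e. `c₁ ≥ log⁺ (2/‖ξ‖)`), a level `V > c₁ N` and a
Markov threshold `t > 0`.

Contents (prefix `soloSS_`):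
* `soloSS_norm_eval_eq` — `‖Q(z)‖ = ‖lc Q‖ · ∏ᵢ ‖z − ρ i‖`;
* `soloSS_prod_norm_sub_ge` — if every root in the disc of radius `r` about `z` is `≥ δ` away,
  `(min 1 r)^D · δ^{m} ≤ ∏ᵢ ‖z − ρ i‖` (`m` = number of root indices in the disc);
* `soloSS_filter_nonempty_of_norm_eval_lt` — `‖Q(z)‖ < (min 1 r)^D` forces a root in the disc;
* `soloSS_exists_root_near` — ONE POINT: `‖Q(z)‖ ≤ e^{−V}`, `V > c₁ N`, `m ≤ t` give a root
  `ρ i` in the disc with `‖ρ i − z‖ ≤ exp (−(V − c₁ N)/t)`;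
* `soloSS_filter_disjoint`, `soloSS_sum_card_filter_le` — the discs of radius `‖ξ‖/2` about
  distinct `z_c` share no root index, so `∑_{c ∈ C} m_c ≤ D`;
* `soloSS_card_crowded_mul_le` — MARKOV: `#{c ∈ C : t < m_c} · t ≤ D`;
* `soloSS_servedSet` — THE LEMMA: there are `S ⊆ C` and `ι : ℕ → Fin D` with
  `#(C \ S) · t ≤ N`, `ι` injective on `S`, and for `c ∈ S` the root `ρ (ι c)` lies in the disc
  about `z_c` with `‖ρ (ι c) − z_c‖ ≤ exp (−(V − c₁ N)/t)`;
* `soloSS_servedSet_int` — the same for `F : ℤ[X]`, `F ≠ 0`, `Q = F.map (Int.castRingHom ℂ)`.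
With `t = 2N/(θ₀ K′)` this is display (§3) of the note: `#(C \ S) ≤ θ₀K′/2`,
`W = (θ₀K′/(2N)) (V − c₁′N)`.

What this is NOT.  One elementary input of the seat's pen-and-paper THEOREMS AE-1 / AE-2 on the
node `RoyAdditiveDirichletExponent` (small value estimates for the additive group,
[cite: Roy2010, Thm 1.1]); those theorems still need the endgame lemma (§6 of the note) and
Roy's Cor 3.2 / Thm 1.2, which are not in the kernel, and nothing here bears on
`Literature.Periods.SchanuelConjecture` (the seat's verdict, no path, is unchanged).  The
mathematics is elementary and claimed by no one as new; Mathlib-only, no definitions, no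
literature hypothesis; axioms the standard three.
-/

namespace Summit.Schanuel.Schanuel.Theorems

open Finset Polynomial

section OnePoint

variable {D : ℕ}

/-- Norm of the value of a complex polynomial whose roots are enumerated (with multiplicity)
by `ρ : Fin D → ℂ`: `‖Q(z)‖ = ‖lc Q‖ · ∏ᵢ ‖z − ρ i‖`. -/
theorem soloSS_norm_eval_eq (Q : ℂ[X]) (ρ : Fin D → ℂ) (hρ : univ.val.map ρ = Q.roots)
    (z : ℂ) : ‖Q.eval z‖ = ‖Q.leadingCoeff‖ * ∏ i, ‖z - ρ i‖ := by
  have h1 : (Q.roots.map (z - ·)).prod = ∏ i, (z - ρ i) := by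
    rw [← hρ, Multiset.map_map, Finset.prod_eq_multiset_prod]
    rfl
  rw [(IsAlgClosed.splits Q).eval_eq_prod_roots z, h1, norm_mul, norm_prod]

/-- If every root (index) in the open disc of radius `r` about `z` is at distance `≥ δ` from
`z`, then `(min 1 r)^D · δ^m ≤ ∏ᵢ ‖z − ρ i‖`, where `m` is the number of root indices in the
disc (roots outside the disc contribute `≥ r ≥ min 1 r` each, and `min 1 r ≤ 1`). -/
theorem soloSS_prod_norm_sub_ge (ρ : Fin D → ℂ) (z : ℂ) {r δ : ℝ} (hr : 0 < r) (hδ : 0 ≤ δ)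
    (hfar : ∀ i, ‖ρ i - z‖ < r → δ ≤ ‖ρ i - z‖) :
    (min 1 r) ^ D * δ ^ #(univ.filter (fun i => ‖ρ i - z‖ < r)) ≤ ∏ i, ‖z - ρ i‖ := by
  have hsplit : ∏ i, ‖z - ρ i‖ = (∏ i ∈ univ.filter (fun i => ‖ρ i - z‖ < r), ‖z - ρ i‖) *
      ∏ i ∈ univ.filter (fun i => ¬ ‖ρ i - z‖ < r), ‖z - ρ i‖ :=
    (Finset.prod_filter_mul_prod_filter_not univ _ _).symm
  have hm0 : 0 ≤ min 1 r := le_min zero_le_one hr.le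
  have hm1 : min 1 r ≤ 1 := min_le_left _ _
  have h1 : δ ^ #(univ.filter (fun i => ‖ρ i - z‖ < r)) ≤
      ∏ i ∈ univ.filter (fun i => ‖ρ i - z‖ < r), ‖z - ρ i‖ := by
    rw [← Finset.prod_const]
    refine Finset.prod_le_prod (fun _ _ => hδ) (fun i hi => ?_)
    rw [norm_sub_rev]
    exact hfar i (Finset.mem_filter.mp hi).2
  have h2 : (min 1 r) ^ D ≤ ∏ i ∈ univ.filter (fun i => ¬ ‖ρ i - z‖ < r), ‖z - ρ i‖ := by
    calc (min 1 r) ^ D ≤ (min 1 r) ^ #(univ.filter (fun i => ¬ ‖ρ i - z‖ < r)) := by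
          apply pow_le_pow_of_le_one hm0 hm1
          exact (Finset.card_le_univ _).trans (by simp)
      _ = ∏ _i ∈ univ.filter (fun i => ¬ ‖ρ i - z‖ < r), min 1 r := (Finset.prod_const _).symm
      _ ≤ ∏ i ∈ univ.filter (fun i => ¬ ‖ρ i - z‖ < r), ‖z - ρ i‖ := by
          refine Finset.prod_le_prod (fun _ _ => hm0) (fun i hi => ?_)
          rw [norm_sub_rev]
          exact (min_le_right _ _).trans (not_lt.mp (Finset.mem_filter.mp hi).2)
  rw [hsplit, mul_comm ((min 1 r) ^ D)]
  exact mul_le_mul h1 h2 (pow_nonneg hm0 _) (Finset.prod_nonneg (fun _ _ => norm_nonneg _))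

/-- If `1 ≤ ‖lc Q‖` and `‖Q(z)‖ < (min 1 r)^D`, some root of `Q` lies in the open disc of
radius `r` about `z`. -/
theorem soloSS_filter_nonempty_of_norm_eval_lt (Q : ℂ[X]) (hlc : 1 ≤ ‖Q.leadingCoeff‖)
    (ρ : Fin D → ℂ) (hρ : univ.val.map ρ = Q.roots) (z : ℂ) {r : ℝ} (hr : 0 < r)
    (hsmall : ‖Q.eval z‖ < (min 1 r) ^ D) :
    (univ.filter (fun i => ‖ρ i - z‖ < r)).Nonempty := by
  by_contra hempty
  rw [Finset.not_nonempty_iff_eq_empty] at hempty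
  have hfar : ∀ i, ‖ρ i - z‖ < r → (1 : ℝ) ≤ ‖ρ i - z‖ := by
    intro i hi
    have hmem : i ∈ univ.filter (fun i => ‖ρ i - z‖ < r) := by simp [hi]
    simp [hempty] at hmem
  have hlb := soloSS_prod_norm_sub_ge ρ z hr zero_le_one hfar
  rw [hempty, card_empty, pow_zero, mul_one] at hlb
  have hle : ∏ i, ‖z - ρ i‖ ≤ ‖Q.eval z‖ := by
    rw [soloSS_norm_eval_eq Q ρ hρ z]
    exact le_mul_of_one_le_left (Finset.prod_nonneg fun _ _ => norm_nonneg _) hlc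
  linarith

/-- **One point.**  `1 ≤ ‖lc Q‖`, `D ≤ N`, `exp (−c₁) ≤ min 1 r`, `c₁ N < V`, at most `t` root
indices in the disc of radius `r` about `z`, and `‖Q(z)‖ ≤ e^{−V}`: then some root `ρ i` in that
disc satisfies `‖ρ i − z‖ ≤ exp (−(V − c₁ N)/t)`. -/
theorem soloSS_exists_root_near {N : ℕ} (Q : ℂ[X]) (hlc : 1 ≤ ‖Q.leadingCoeff‖)
    (ρ : Fin D → ℂ) (hρ : univ.val.map ρ = Q.roots) (hDN : D ≤ N) (z : ℂ) {r c₁ V t : ℝ}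
    (hr : 0 < r) (hc : Real.exp (-c₁) ≤ min 1 r) (hV : c₁ * N < V)
    (ht : (#(univ.filter (fun i => ‖ρ i - z‖ < r)) : ℝ) ≤ t)
    (hsmall : ‖Q.eval z‖ ≤ Real.exp (-V)) :
    ∃ i, ‖ρ i - z‖ < r ∧ ‖ρ i - z‖ ≤ Real.exp (-(V - c₁ * N) / t) := by
  have hc₁ : 0 ≤ c₁ := by
    by_contra h
    rw [not_le] at h
    have h1 : (1 : ℝ) < Real.exp (-c₁) := by
      rw [← Real.exp_zero]
      exact Real.exp_lt_exp.mpr (by linarith)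
    linarith [min_le_left (1 : ℝ) r]
  have hpow : Real.exp (-(c₁ * N)) ≤ (min 1 r) ^ D := by
    calc Real.exp (-(c₁ * N)) ≤ Real.exp (-(c₁ * D)) := by
          apply Real.exp_le_exp.mpr
          have : (D : ℝ) ≤ N := by exact_mod_cast hDN
          nlinarith
      _ = Real.exp (-c₁) ^ D := by
          rw [← Real.exp_nat_mul]; ring_nf
      _ ≤ (min 1 r) ^ D := pow_le_pow_left₀ (Real.exp_pos _).le hc D
  have hlt : ‖Q.eval z‖ < (min 1 r) ^ D := by
    calc ‖Q.eval z‖ ≤ Real.exp (-V) := hsmall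
      _ < Real.exp (-(c₁ * N)) := Real.exp_lt_exp.mpr (by linarith)
      _ ≤ _ := hpow
  have hne := soloSS_filter_nonempty_of_norm_eval_lt Q hlc ρ hρ z hr hlt
  obtain ⟨i₀, hi₀B, hmin⟩ :=
    Finset.exists_min_image (univ.filter (fun i => ‖ρ i - z‖ < r)) (fun i => ‖ρ i - z‖) hne
  have hi₀r : ‖ρ i₀ - z‖ < r := (Finset.mem_filter.mp hi₀B).2
  refine ⟨i₀, hi₀r, ?_⟩
  have hδ0 : 0 ≤ ‖ρ i₀ - z‖ := norm_nonneg _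
  have hlb := soloSS_prod_norm_sub_ge ρ z hr hδ0
    (fun i hi => hmin i (Finset.mem_filter.mpr ⟨mem_univ _, hi⟩))
  have hprod_le : ∏ i, ‖z - ρ i‖ ≤ Real.exp (-V) := by
    have : ∏ i, ‖z - ρ i‖ ≤ ‖Q.eval z‖ := by
      rw [soloSS_norm_eval_eq Q ρ hρ z]
      exact le_mul_of_one_le_left (Finset.prod_nonneg fun _ _ => norm_nonneg _) hlc
    exact this.trans hsmall
  have hkey : ‖ρ i₀ - z‖ ^ #(univ.filter (fun i => ‖ρ i - z‖ < r)) ≤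
      Real.exp (-(V - c₁ * N)) := by
    have h1 : Real.exp (-(c₁ * N)) * ‖ρ i₀ - z‖ ^ #(univ.filter (fun i => ‖ρ i - z‖ < r)) ≤
        Real.exp (-V) :=
      (mul_le_mul_of_nonneg_right hpow (pow_nonneg hδ0 _)).trans (hlb.trans hprod_le)
    have h2 : Real.exp (-(V - c₁ * N)) = Real.exp (-V) / Real.exp (-(c₁ * N)) := by
      rw [← Real.exp_sub]; ring_nf
    rw [h2, le_div_iff₀ (Real.exp_pos _), mul_comm]
    exact h1
  rcases hδ0.eq_or_lt with hδz | hδpos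
  · rw [← hδz]; exact (Real.exp_pos _).le
  · have hBpos : (0 : ℝ) < #(univ.filter (fun i => ‖ρ i - z‖ < r)) := by
      exact_mod_cast hne.card_pos
    have hVN : 0 < V - c₁ * N := by linarith
    rw [← Real.log_le_iff_le_exp hδpos]
    have hlog : (#(univ.filter (fun i => ‖ρ i - z‖ < r)) : ℝ) * Real.log ‖ρ i₀ - z‖ ≤
        -(V - c₁ * N) := by
      have := Real.log_le_log (pow_pos hδpos _) hkey
      rwa [Real.log_exp, Real.log_pow] at this
    have h3 : Real.log ‖ρ i₀ - z‖ ≤ -(V - c₁ * N) / #(univ.filter (fun i => ‖ρ i - z‖ < r)) := by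
      rw [le_div_iff₀ hBpos, mul_comm]
      exact hlog
    refine h3.trans ?_
    rw [neg_div, neg_div, neg_le_neg_iff]
    exact div_le_div_of_nonneg_left hVN.le hBpos ht

end OnePoint

section Discs

variable {D : ℕ}

/-- The open discs of radius `‖ξ‖/2` about two distinct points `c ξ + η`, `c' ξ + η`
(`c ≠ c'` naturals) contain no common root index. -/
theorem soloSS_filter_disjoint (ρ : Fin D → ℂ) (ξ η : ℂ) {c c' : ℕ} (hcc : c ≠ c') :
    Disjoint (univ.filter (fun i => ‖ρ i - (c * ξ + η)‖ < ‖ξ‖ / 2))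
      (univ.filter (fun i => ‖ρ i - (c' * ξ + η)‖ < ‖ξ‖ / 2)) := by
  rw [Finset.disjoint_filter]
  intro i _ h1 h2
  have hdist : ‖((c : ℂ) * ξ + η) - (c' * ξ + η)‖ = |(c : ℝ) - c'| * ‖ξ‖ := by
    have : ((c : ℂ) * ξ + η) - (c' * ξ + η) = (((c : ℝ) - c' : ℝ) : ℂ) * ξ := by
      push_cast; ring
    rw [this, norm_mul, Complex.norm_real, Real.norm_eq_abs]
  have h1le : (1 : ℝ) ≤ |(c : ℝ) - c'| := by
    rcases Nat.lt_or_gt_of_ne hcc with h | h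
    · have : (c : ℝ) + 1 ≤ c' := by exact_mod_cast h
      rw [abs_sub_comm]
      exact le_trans (by linarith) (le_abs_self _)
    · have : (c' : ℝ) + 1 ≤ c := by exact_mod_cast h
      exact le_trans (by linarith) (le_abs_self _)
  have hge : ‖ξ‖ ≤ ‖((c : ℂ) * ξ + η) - (c' * ξ + η)‖ := by
    rw [hdist]
    calc ‖ξ‖ = 1 * ‖ξ‖ := (one_mul _).symm
      _ ≤ |(c : ℝ) - c'| * ‖ξ‖ := mul_le_mul_of_nonneg_right h1le (norm_nonneg _)
  have htri : ‖((c : ℂ) * ξ + η) - (c' * ξ + η)‖ ≤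
      ‖ρ i - (c * ξ + η)‖ + ‖ρ i - (c' * ξ + η)‖ := by
    calc ‖((c : ℂ) * ξ + η) - (c' * ξ + η)‖
        = ‖(ρ i - (c' * ξ + η)) - (ρ i - (c * ξ + η))‖ := by congr 1; ring
      _ ≤ ‖ρ i - (c' * ξ + η)‖ + ‖ρ i - (c * ξ + η)‖ := norm_sub_le _ _
      _ = ‖ρ i - (c * ξ + η)‖ + ‖ρ i - (c' * ξ + η)‖ := add_comm _ _
  linarith

/-- Since the discs about distinct points are disjoint, the total number of root indices in
the discs about the points `c ξ + η`, `c ∈ C`, is at most `D`. -/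
theorem soloSS_sum_card_filter_le (ρ : Fin D → ℂ) (ξ η : ℂ) (C : Finset ℕ) :
    ∑ c ∈ C, #(univ.filter (fun i => ‖ρ i - (c * ξ + η)‖ < ‖ξ‖ / 2)) ≤ D := by
  rw [← Finset.card_biUnion]
  · exact (Finset.card_le_univ _).trans (by simp)
  · intro c _ c' _ hcc
    exact soloSS_filter_disjoint ρ ξ η hcc

/-- **Markov step.**  The number of CROWDED points (`t < m_c`, `m_c` = number of root indices
in the disc about `c ξ + η`) times `t` is at most `D`. -/
theorem soloSS_card_crowded_mul_le (ρ : Fin D → ℂ) (ξ η : ℂ) (C : Finset ℕ) (t : ℝ) :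
    (#(C.filter (fun c : ℕ =>
        t < #(univ.filter (fun i => ‖ρ i - (c * ξ + η)‖ < ‖ξ‖ / 2)))) : ℝ) * t ≤ D := by
  set m : ℕ → ℕ := fun c => #(univ.filter (fun i => ‖ρ i - (c * ξ + η)‖ < ‖ξ‖ / 2)) with hm
  calc (#(C.filter (fun c => t < (m c : ℝ))) : ℝ) * t
        = ∑ _c ∈ C.filter (fun c => t < (m c : ℝ)), t := by
        rw [Finset.sum_const, nsmul_eq_mul]
    _ ≤ ∑ c ∈ C.filter (fun c => t < (m c : ℝ)), (m c : ℝ) :=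
        Finset.sum_le_sum (fun c hc => ((Finset.mem_filter.mp hc).2).le)
    _ ≤ ∑ c ∈ C, (m c : ℝ) :=
        Finset.sum_le_sum_of_subset_of_nonneg (Finset.filter_subset _ _)
          (fun _ _ _ => Nat.cast_nonneg _)
    _ ≤ D := by exact_mod_cast soloSS_sum_card_filter_le ρ ξ η C

end Discs

section ServedSet

variable {D : ℕ}

/-- **The served-set lemma** (AE-note §3, kernel form).  Let `Q : ℂ[X]` with `1 ≤ ‖lc Q‖`,
roots enumerated by `ρ : Fin D → ℂ` (`0 < D ≤ N`), `exp (−c₁) ≤ min 1 (‖ξ‖/2)`, `c₁ N < V`,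
and suppose `‖Q(c ξ + η)‖ ≤ e^{−V}` for every `c ∈ C`.  Then for every real `t` there are
`S ⊆ C` and `ι : ℕ → Fin D` such that `#(C \ S) · t ≤ N`, `ι` is injective on `S`, and for
`c ∈ S` the root `ρ (ι c)` lies in the open disc of radius `‖ξ‖/2` about `c ξ + η` with
`‖ρ (ι c) − (c ξ + η)‖ ≤ exp (−(V − c₁ N)/t)`.  (`S` = the uncrowded points, `m_c ≤ t`.) -/
theorem soloSS_servedSet {N : ℕ} (Q : ℂ[X]) (hlc : 1 ≤ ‖Q.leadingCoeff‖) (ρ : Fin D → ℂ)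
    (hρ : univ.val.map ρ = Q.roots) (hD0 : 0 < D) (hDN : D ≤ N) (ξ η : ℂ) (C : Finset ℕ)
    {c₁ V : ℝ} (t : ℝ) (hc : Real.exp (-c₁) ≤ min 1 (‖ξ‖ / 2)) (hV : c₁ * N < V)
    (hsmall : ∀ c ∈ C, ‖Q.eval (c * ξ + η)‖ ≤ Real.exp (-V)) :
    ∃ S ⊆ C, ∃ ι : ℕ → Fin D,
      (#(C \ S) : ℝ) * t ≤ N ∧ Set.InjOn ι S ∧
      (∀ c ∈ S, ‖ρ (ι c) - (c * ξ + η)‖ < ‖ξ‖ / 2) ∧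
      ∀ c ∈ S, ‖ρ (ι c) - (c * ξ + η)‖ ≤ Real.exp (-(V - c₁ * N) / t) := by
  classical
  haveI : Nonempty (Fin D) := ⟨⟨0, hD0⟩⟩
  have hr : 0 < ‖ξ‖ / 2 := (Real.exp_pos (-c₁)).trans_le (hc.trans (min_le_right _ _))
  set m : ℕ → ℕ := fun c => #(univ.filter (fun i => ‖ρ i - (c * ξ + η)‖ < ‖ξ‖ / 2)) with hm
  have hnear : ∀ c ∈ C.filter (fun c => (m c : ℝ) ≤ t), ∃ i, ‖ρ i - (c * ξ + η)‖ < ‖ξ‖ / 2 ∧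
      ‖ρ i - (c * ξ + η)‖ ≤ Real.exp (-(V - c₁ * N) / t) := by
    intro c hcS
    obtain ⟨hcC, hct⟩ := Finset.mem_filter.mp hcS
    exact soloSS_exists_root_near Q hlc ρ hρ hDN _ hr hc hV hct (hsmall c hcC)
  choose! ι hι using hnear
  refine ⟨C.filter (fun c => (m c : ℝ) ≤ t), Finset.filter_subset _ _, ι, ?_, ?_,
    fun c hc => (hι c hc).1, fun c hc => (hι c hc).2⟩
  · have hCS : C \ C.filter (fun c => (m c : ℝ) ≤ t) = C.filter (fun c => t < (m c : ℝ)) := by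
      ext c
      simp only [Finset.mem_sdiff, Finset.mem_filter, not_and, not_le]
      constructor
      · intro h; exact ⟨h.1, h.2 h.1⟩
      · intro h; exact ⟨h.1, fun _ => h.2⟩
    rw [hCS]
    refine (soloSS_card_crowded_mul_le ρ ξ η C t).trans ?_
    exact_mod_cast hDN
  · intro c hc c' hc' hcc
    by_contra hne
    have hdis := soloSS_filter_disjoint ρ ξ η hne
    have h1 : ι c ∈ univ.filter (fun i => ‖ρ i - (c * ξ + η)‖ < ‖ξ‖ / 2) := by
      simp [(hι c hc).1]
    have h2 : ι c' ∈ univ.filter (fun i => ‖ρ i - (c' * ξ + η)‖ < ‖ξ‖ / 2) := by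
      simp [(hι c' hc').1]
    rw [hcc] at h1
    exact Finset.disjoint_left.mp hdis h1 h2

/-- **The served-set lemma for an integer polynomial.**  `F : ℤ[X]`, `F ≠ 0`, complex roots
of `F.map (Int.castRingHom ℂ)` enumerated by `ρ : Fin D → ℂ` (`0 < D ≤ N`); the rest as in
`soloSS_servedSet` (`1 ≤ ‖lc‖` is automatic: the leading coefficient is a non-zero integer). -/
theorem soloSS_servedSet_int {N : ℕ} (F : ℤ[X]) (hF : F ≠ 0) (ρ : Fin D → ℂ)
    (hρ : univ.val.map ρ = (F.map (Int.castRingHom ℂ)).roots) (hD0 : 0 < D) (hDN : D ≤ N)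
    (ξ η : ℂ) (C : Finset ℕ) {c₁ V : ℝ} (t : ℝ) (hc : Real.exp (-c₁) ≤ min 1 (‖ξ‖ / 2))
    (hV : c₁ * N < V)
    (hsmall : ∀ c ∈ C, ‖(F.map (Int.castRingHom ℂ)).eval (c * ξ + η)‖ ≤ Real.exp (-V)) :
    ∃ S ⊆ C, ∃ ι : ℕ → Fin D,
      (#(C \ S) : ℝ) * t ≤ N ∧ Set.InjOn ι S ∧
      (∀ c ∈ S, ‖ρ (ι c) - (c * ξ + η)‖ < ‖ξ‖ / 2) ∧
      ∀ c ∈ S, ‖ρ (ι c) - (c * ξ + η)‖ ≤ Real.exp (-(V - c₁ * N) / t) := by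
  have hlc : 1 ≤ ‖(F.map (Int.castRingHom ℂ)).leadingCoeff‖ := by
    rw [leadingCoeff_map_of_injective Int.cast_injective, eq_intCast, Complex.norm_intCast]
    exact_mod_cast Int.one_le_abs (leadingCoeff_ne_zero.mpr hF)
  exact soloSS_servedSet _ hlc ρ hρ hD0 hDN ξ η C t hc hV hsmall

end ServedSet

end Summit.Schanuel.Schanuel.Theorems
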